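import Mathlib.MeasureTheory.Integral.IntegralEqImproper
import Mathlib.Algebra.Order.Field.Pointwise
import Literature.Analysis.Fourier.FractalUncertaintyFourierTools
import HarnessLib

/-!
# The smoothed cut-off weights `Ψ = 1_U * φ_ρ` of BD18 §3.4

Topic `Literature/Analysis/Fourier`. In the iteration argument of J. Bourgain, S. Dyatlov,
*Spectral gaps without the pressure condition*, Ann. of Math. 187 (2018), §3.4, the weight at
scale `L^{-n}` is `Ψ_n = 1_{U_{n+1}} * φ_{n+T}` with `φ_k(x) = L^k φ(L^k x)`, `φ ≥ 0`, `∫ φ = 1`,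
`supp φ̂ ⊂ [-1, 1]`. This file proves the properties of such weights that the argument uses, for a
general measurable set `U`, kernel `φ` and scale `ρ > 0` (all sorry-free, no definitions; the
weight is the expression `(1_U ⋆ (y ↦ ρ φ(ρ y))) x`):

* `weight_nonneg`, `weight_le_one` — `0 ≤ Ψ ≤ 1` (BD18: "Note that ... `0 ≤ Ψ_n ≤ 1`");
* `le_weight_of_Icc_subset` — `Ψ(x) ≥ ∫_{[-ρr, ρr]} φ` if `[x-r, x+r] ⊂ U` (BD18 Lemma 3.4, the
  lower bound `Ψ_n ≥ 1 - C_φ L^{1-T}` on `X`);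
* `weight_le_of_disjoint` — `Ψ(x) ≤ 1 - ∫_{[-ρr, ρr]} φ` if `[x-r, x+r] ∩ U = ∅` (BD18 (3.27) ff.:
  `Ψ_n ≤ c_φ` on `L^{-n}U'`);
* `exists_mass_Icc_ge` — `∫_{[-R,R]} φ → 1`, in the form used to fix `T`;
* `exists_fourier_repr_weight` — `Ψ = 𝓕⁻ w` with `w` continuous, integrable, bounded and
  vanishing off `[-ρ, ρ]` when `φ = 𝓕⁻ u`, `supp u ⊂ [-1,1]` (BD18: `supp Ψ̂_n ⊂ [-L^{n+T}, L^{n+T}]`),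
  via Mathlib's convolution theorem and Fourier inversion.
-/

namespace Literature.Analysis.Fourier

open _root_.MeasureTheory Set Function Filter
open scoped FourierTransform ENNReal Convolution Pointwise Real Topology

section RealWeight

variable {U : Set ℝ} {φ : ℝ → ℝ} {ρ : ℝ}

/-- The scaled kernel `y ↦ ρ φ(ρ y)` is integrable (`ρ > 0`). [folklore] -/
theorem integrable_scaledKernel (hφ : Integrable φ) (hρ : 0 < ρ) :
    Integrable (fun y => ρ * φ (ρ * y)) :=
  (hφ.comp_mul_left' hρ.ne').const_mul ρ

/-- `∫ ρ φ(ρ y) dy = ∫ φ` (`ρ > 0`). [folklore] -/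
theorem integral_scaledKernel (hρ : 0 < ρ) : ∫ y, ρ * φ (ρ * y) = ∫ z, φ z := by
  rw [integral_const_mul, Measure.integral_comp_mul_left (fun z => φ z) ρ, smul_eq_mul,
    abs_of_pos (inv_pos.2 hρ), ← mul_assoc, mul_inv_cancel₀ hρ.ne', one_mul]

/-- `∫_{[-r,r]} ρ φ(ρ y) dy = ∫_{[-ρr, ρr]} φ` (`ρ > 0`). [folklore] -/
theorem setIntegral_scaledKernel_Icc (hρ : 0 < ρ) (r : ℝ) :
    ∫ y in Icc (-r) r, ρ * φ (ρ * y) = ∫ z in Icc (-(ρ * r)) (ρ * r), φ z := by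
  rw [integral_const_mul]
  have := Measure.setIntegral_comp_smul_of_pos volume (fun z => φ z) (Icc (-r) r) hρ
  simp only [smul_eq_mul, Module.finrank_self, pow_one] at this
  rw [this, ← mul_assoc, mul_inv_cancel₀ hρ.ne', one_mul, LinearOrderedField.smul_Icc hρ,
    mul_neg]

/-- `0 ≤ Ψ` for `φ ≥ 0`, `ρ > 0`. [cite: BourgainDyatlov2018, §3.4] -/
theorem weight_nonneg (hφ0 : ∀ x, 0 ≤ φ x) (hρ : 0 < ρ) (x : ℝ) :
    0 ≤ (U.indicator (fun _ => (1 : ℝ)) ⋆[ContinuousLinearMap.mul ℝ ℝ, volume]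
        fun y => ρ * φ (ρ * y)) x := by
  rw [convolution_mul_swap]
  apply integral_nonneg
  intro t
  apply mul_nonneg (Set.indicator_nonneg (fun _ _ => zero_le_one) _)
  exact mul_nonneg hρ.le (hφ0 _)

/-- Pointwise bounds on the integrand of `Ψ`. [folklore] -/
private theorem weight_integrand_bounds (hφ0 : ∀ x, 0 ≤ φ x) (hρ : 0 < ρ) (x t : ℝ) :
    0 ≤ (U.indicator (fun _ => (1 : ℝ)) (x - t)) * (ρ * φ (ρ * t)) ∧
      (U.indicator (fun _ => (1 : ℝ)) (x - t)) * (ρ * φ (ρ * t)) ≤ ρ * φ (ρ * t) := by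
  have h1 : 0 ≤ ρ * φ (ρ * t) := mul_nonneg hρ.le (hφ0 _)
  have h2 : 0 ≤ U.indicator (fun _ => (1 : ℝ)) (x - t) :=
    Set.indicator_nonneg (fun _ _ => zero_le_one) _
  have h3 : U.indicator (fun _ => (1 : ℝ)) (x - t) ≤ 1 :=
    Set.indicator_le_self' (fun _ _ => zero_le_one) _
  exact ⟨mul_nonneg h2 h1, by nlinarith⟩

/-- `Ψ ≤ 1` for `φ ≥ 0`, `∫ φ = 1`, `ρ > 0`. [cite: BourgainDyatlov2018, §3.4] -/
theorem weight_le_one (hφ0 : ∀ x, 0 ≤ φ x) (hφ : Integrable φ) (hφ1 : ∫ x, φ x = 1)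
    (hρ : 0 < ρ) (x : ℝ) :
    (U.indicator (fun _ => (1 : ℝ)) ⋆[ContinuousLinearMap.mul ℝ ℝ, volume]
        fun y => ρ * φ (ρ * y)) x ≤ 1 := by
  have h1 : ∫ y, ρ * φ (ρ * y) = 1 := by rw [integral_scaledKernel hρ, hφ1]
  rw [convolution_mul_swap]
  calc ∫ t, (U.indicator (fun _ => (1 : ℝ)) (x - t)) * (ρ * φ (ρ * t))
      ≤ ∫ y, ρ * φ (ρ * y) := by
        apply integral_mono_of_nonneg
        · exact Eventually.of_forall fun t => (weight_integrand_bounds hφ0 hρ x t).1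
        · exact integrable_scaledKernel hφ hρ
        · exact Eventually.of_forall fun t => (weight_integrand_bounds hφ0 hρ x t).2
    _ = 1 := h1

/-- The integrand of `Ψ` is integrable when `U` is measurable. [folklore] -/
private theorem weight_integrand_integrable (hU : MeasurableSet U) (hφ0 : ∀ x, 0 ≤ φ x)
    (hφ : Integrable φ) (hρ : 0 < ρ) (x : ℝ) :
    Integrable (fun t => (U.indicator (fun _ => (1 : ℝ)) (x - t)) * (ρ * φ (ρ * t))) := by
  refine (integrable_scaledKernel hφ hρ).mono' ?_ (Eventually.of_forall fun t => ?_)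
  · refine AEStronglyMeasurable.mul ?_ (integrable_scaledKernel hφ hρ).aestronglyMeasurable
    exact ((measurable_const.indicator hU).comp (measurable_const.sub measurable_id)).aestronglyMeasurable
  · rw [Real.norm_of_nonneg (weight_integrand_bounds hφ0 hρ x t).1]
    exact (weight_integrand_bounds hφ0 hρ x t).2

/-- **Lower bound near `U`** (BD18 Lemma 3.4): if `[x-r, x+r] ⊂ U` then
`Ψ(x) ≥ ∫_{[-ρr, ρr]} φ`. [cite: BourgainDyatlov2018, Lemma 3.4] -/
theorem le_weight_of_Icc_subset (hU : MeasurableSet U) (hφ0 : ∀ x, 0 ≤ φ x) (hφ : Integrable φ)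
    (hρ : 0 < ρ) {x r : ℝ} (hxU : Icc (x - r) (x + r) ⊆ U) :
    ∫ z in Icc (-(ρ * r)) (ρ * r), φ z ≤
      (U.indicator (fun _ => (1 : ℝ)) ⋆[ContinuousLinearMap.mul ℝ ℝ, volume]
        fun y => ρ * φ (ρ * y)) x := by
  rw [convolution_mul_swap, ← setIntegral_scaledKernel_Icc hρ, ← integral_indicator measurableSet_Icc]
  apply integral_mono_of_nonneg
  · exact Eventually.of_forall fun t =>
      Set.indicator_nonneg (fun _ _ => mul_nonneg hρ.le (hφ0 _)) _
  · exact weight_integrand_integrable hU hφ0 hφ hρ x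
  · refine Eventually.of_forall fun t => ?_
    by_cases ht : t ∈ Icc (-r) r
    · have hxt : x - t ∈ U := hxU ⟨by linarith [ht.2], by linarith [ht.1]⟩
      simp [ht, hxt]
    · simp only [ht, not_false_eq_true, indicator_of_notMem]
      exact (weight_integrand_bounds hφ0 hρ x t).1

/-- **Upper bound away from `U`** (BD18, after (3.27)): if `[x-r, x+r] ∩ U = ∅` then
`Ψ(x) ≤ 1 - ∫_{[-ρr, ρr]} φ` (`= ∫_{|z| > ρr} φ`). [cite: BourgainDyatlov2018, §3.4 (3.27)] -/
theorem weight_le_of_disjoint (hφ0 : ∀ x, 0 ≤ φ x) (hφ : Integrable φ)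
    (hφ1 : ∫ x, φ x = 1) (hρ : 0 < ρ) {x r : ℝ} (hxU : Disjoint (Icc (x - r) (x + r)) U) :
    (U.indicator (fun _ => (1 : ℝ)) ⋆[ContinuousLinearMap.mul ℝ ℝ, volume]
        fun y => ρ * φ (ρ * y)) x ≤ 1 - ∫ z in Icc (-(ρ * r)) (ρ * r), φ z := by
  have hk := integrable_scaledKernel (φ := φ) hφ hρ
  have hsplit := integral_add_compl (measurableSet_Icc (a := -r) (b := r)) hk
  rw [integral_scaledKernel hρ, hφ1, setIntegral_scaledKernel_Icc hρ] at hsplit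
  have hB : (1 : ℝ) - ∫ z in Icc (-(ρ * r)) (ρ * r), φ z = ∫ y in (Icc (-r) r)ᶜ, ρ * φ (ρ * y) := by
    linarith
  rw [convolution_mul_swap, hB, ← integral_indicator measurableSet_Icc.compl]
  apply integral_mono_of_nonneg
  · exact Eventually.of_forall fun t => (weight_integrand_bounds hφ0 hρ x t).1
  · exact hk.indicator measurableSet_Icc.compl
  · refine Eventually.of_forall fun t => ?_
    by_cases ht : t ∈ Icc (-r) r
    · have hxt : x - t ∉ U := by
        intro h
        exact Set.disjoint_left.1 hxU ⟨by linarith [ht.2], by linarith [ht.1]⟩ h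
      simp [hxt, Set.mem_compl_iff, ht]
    · have : t ∈ (Icc (-r) r)ᶜ := ht
      simp only [this, indicator_of_mem]
      exact (weight_integrand_bounds hφ0 hρ x t).2

/-- The central mass `∫_{[-R,R]} φ` tends to `∫ φ = 1`; in particular it eventually exceeds any
`1 - ε` and is monotone in `R`. [folklore] -/
theorem exists_mass_Icc_ge (hφ0 : ∀ x, 0 ≤ φ x) (hφ : Integrable φ) (hφ1 : ∫ x, φ x = 1)
    {ε : ℝ} (hε : 0 < ε) : ∃ R₀ : ℝ, 0 < R₀ ∧ ∀ R, R₀ ≤ R → 1 - ε ≤ ∫ z in Icc (-R) R, φ z := by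
  have hcover : AECover volume atTop (fun R : ℝ => Icc (-R) R) :=
    aecover_Icc tendsto_neg_atTop_atBot tendsto_id
  have hlim := hcover.integral_tendsto_of_countably_generated hφ
  rw [hφ1] at hlim
  have hev : ∀ᶠ R in atTop, 1 - ε < ∫ z in Icc (-R) R, φ z :=
    hlim.eventually (lt_mem_nhds (by linarith))
  obtain ⟨R₁, hR₁⟩ := Filter.eventually_atTop.1 hev
  refine ⟨max R₁ 1, by positivity, fun R hR => ?_⟩
  have h1 : 1 - ε < ∫ z in Icc (-max R₁ 1) (max R₁ 1), φ z := hR₁ _ (le_max_left _ _)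
  have h2 : ∫ z in Icc (-max R₁ 1) (max R₁ 1), φ z ≤ ∫ z in Icc (-R) R, φ z := by
    apply setIntegral_mono_set hφ.integrableOn (Eventually.of_forall hφ0)
    apply Eventually.of_forall
    intro z hz
    exact ⟨by linarith [hz.1], by linarith [hz.2]⟩
  linarith

end RealWeight

section FourierSide

variable {U : Set ℝ} {φ : ℝ → ℝ} {ρ : ℝ} {u : ℝ → ℂ}

/-- `𝓕⁻ (ξ ↦ u(ξ/ρ)) (y) = ρ 𝓕⁻ u (ρ y)` for `ρ > 0`. [folklore] -/
theorem fourierInv_comp_div_eq (hρ : 0 < ρ) (y : ℝ) :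
    (𝓕⁻ (fun ξ => u (ξ / ρ)) : ℝ → ℂ) y = (ρ : ℂ) * (𝓕⁻ u : ℝ → ℂ) (ρ * y) := by
  rw [fourierInv_real_eq, fourierInv_real_eq]
  have key : (fun v : ℝ => 𝐞 (v * y) • u (v / ρ)) =
      fun v => (fun s : ℝ => 𝐞 (s * (ρ * y)) • u s) (ρ⁻¹ * v) := by
    funext v
    simp only
    congr 2
    · field_simp
    · rw [div_eq_inv_mul]
  rw [key, Measure.integral_comp_inv_mul_left (fun s : ℝ => 𝐞 (s * (ρ * y)) • u s) ρ,
    abs_of_pos hρ, Complex.real_smul]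

/-- **Fourier representation of the weight** (BD18 §3.4: `Ψ_n` is Schwartz with
`supp Ψ̂_n ⊂ [-L^{n+T}, L^{n+T}]`). If `U` is bounded and measurable and `φ = 𝓕⁻ u` with `u`
continuous with `u = 0` off `[-1, 1]`, then `Ψ = 1_U ⋆ φ_ρ = 𝓕⁻ w` for some continuous,
integrable, bounded `w` vanishing off `[-ρ, ρ]` (namely `w = 𝓕(1_U) · u(·/ρ)`).
[cite: BourgainDyatlov2018, Lemma 3.5] -/
theorem exists_fourier_repr_weight (hU : MeasurableSet U) (hUb : Bornology.IsBounded U)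
    (hφ : Integrable φ) (hu : Continuous u)
    (hu0 : ∀ ξ, ξ ∉ Icc (-1 : ℝ) 1 → u ξ = 0) (hφu : ∀ x, (φ x : ℂ) = (𝓕⁻ u : ℝ → ℂ) x)
    (hρ : 0 < ρ) :
    ∃ w : ℝ → ℂ, Continuous w ∧ Integrable w ∧ (∃ C, ∀ ξ, ‖w ξ‖ ≤ C) ∧
      (∀ ξ, ξ ∉ Icc (-ρ) ρ → w ξ = 0) ∧
      ∀ x, (((U.indicator (fun _ => (1 : ℝ)) ⋆[ContinuousLinearMap.mul ℝ ℝ, volume]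
        fun y => ρ * φ (ρ * y)) x : ℝ) : ℂ) = (𝓕⁻ w : ℝ → ℂ) x := by
  -- complexified indicator and kernel
  set oc : ℝ → ℂ := U.indicator (fun _ => (1 : ℂ)) with hoc
  set kc : ℝ → ℂ := fun y => ((ρ * φ (ρ * y) : ℝ) : ℂ) with hkc
  have hoc_meas : AEStronglyMeasurable oc volume :=
    (measurable_const.indicator hU).aestronglyMeasurable
  have hoc_bd : ∀ t, ‖oc t‖ ≤ 1 := by
    intro t
    by_cases ht : t ∈ U <;> simp [hoc, ht]
  have hoc_zero : ∀ t, t ∉ U → oc t = 0 := fun t ht => by simp [hoc, ht]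
  have hoc_int : Integrable oc := integrable_of_bounded_of_vanish hoc_meas hoc_bd hoc_zero hUb
  have hkc_int : Integrable kc := (integrable_scaledKernel hφ hρ).ofReal
  have hu_supp : HasCompactSupport u := HasCompactSupport.intro isCompact_Icc hu0
  obtain ⟨Cu, hCu⟩ := hu.bounded_above_of_compact_support hu_supp
  -- the kernel is `𝓕⁻` of `u(·/ρ)`
  set uρ : ℝ → ℂ := fun ξ => u (ξ / ρ) with huρ
  have huρ_cont : Continuous uρ := hu.comp (continuous_id.div_const ρ)
  have huρ_zero : ∀ ξ, ξ ∉ Icc (-ρ) ρ → uρ ξ = 0 := by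
    intro ξ hξ
    apply hu0
    intro h
    apply hξ
    rw [mem_Icc, div_le_iff₀ hρ, le_div_iff₀ hρ] at h
    constructor <;> nlinarith [h.1, h.2]
  have huρ_supp : HasCompactSupport uρ := HasCompactSupport.intro isCompact_Icc huρ_zero
  have huρ_int : Integrable uρ := huρ_cont.integrable_of_hasCompactSupport huρ_supp
  have hkc_eq : ∀ y, kc y = (𝓕⁻ uρ : ℝ → ℂ) y := by
    intro y
    rw [huρ, fourierInv_comp_div_eq hρ, ← hφu]
    simp [hkc]
  have hkc_eq' : (𝓕⁻ uρ : ℝ → ℂ) = kc := funext fun y => (hkc_eq y).symm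
  have hkc_cont : Continuous kc := by
    rw [← hkc_eq', Real.fourierInv_eq_fourier_comp_neg]
    exact Literature.Analysis.FunctionSpaces.continuous_fourierIntegral huρ_int.comp_neg
  have hkc_bdd : BddAbove (range fun y => ‖kc y‖) := by
    refine ⟨(ρ : ℝ) * ∫ ξ, ‖u ξ‖, ?_⟩
    rintro _ ⟨y, rfl⟩
    simp only
    rw [hkc_eq y, huρ, fourierInv_comp_div_eq hρ, norm_mul, Complex.norm_real, Real.norm_eq_abs,
      abs_of_pos hρ]
    gcongr
    exact VectorFourier.norm_fourierIntegral_le_integral_norm _ _ _ _ _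
  -- Fourier transform of the kernel
  have hFkc : 𝓕 kc = uρ := by
    rw [← hkc_eq']
    apply huρ_cont.fourier_fourierInv_eq huρ_int
    have : (𝓕 uρ : ℝ → ℂ) = fun ξ => kc (-ξ) := by
      funext ξ
      rw [← hkc_eq', Real.fourierInv_eq_fourier_neg, neg_neg]
    rw [this]
    exact hkc_int.comp_neg
  -- the complex weight
  set Ψc : ℝ → ℂ := oc ⋆[ContinuousLinearMap.mul ℂ ℂ, volume] kc with hΨc
  have hΨc_cont : Continuous Ψc :=
    hkc_bdd.continuous_convolution_right_of_integrable (ContinuousLinearMap.mul ℂ ℂ) hoc_int hkc_cont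
  have hΨc_int : Integrable Ψc := hoc_int.integrable_convolution _ hkc_int
  have hFΨc : ∀ ξ, 𝓕 Ψc ξ = 𝓕 oc ξ * uρ ξ := by
    intro ξ
    rw [hΨc, Real.fourier_mul_convolution_eq hoc_int hkc_int ξ, hFkc]
  -- properties of `w = 𝓕 Ψc`
  have hFoc_cont : Continuous (𝓕 oc : ℝ → ℂ) :=
    Literature.Analysis.FunctionSpaces.continuous_fourierIntegral hoc_int
  have hw_cont : Continuous (𝓕 Ψc : ℝ → ℂ) := by
    have : (𝓕 Ψc : ℝ → ℂ) = fun ξ => 𝓕 oc ξ * uρ ξ := funext hFΨc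
    rw [this]
    exact hFoc_cont.mul huρ_cont
  have hw_zero : ∀ ξ, ξ ∉ Icc (-ρ) ρ → (𝓕 Ψc : ℝ → ℂ) ξ = 0 := by
    intro ξ hξ
    rw [hFΨc, huρ_zero ξ hξ, mul_zero]
  have hw_int : Integrable (𝓕 Ψc : ℝ → ℂ) :=
    hw_cont.integrable_of_hasCompactSupport (HasCompactSupport.intro isCompact_Icc hw_zero)
  have hw_bd : ∃ C, ∀ ξ, ‖(𝓕 Ψc : ℝ → ℂ) ξ‖ ≤ C := by
    refine ⟨(∫ t, ‖oc t‖) * Cu, fun ξ => ?_⟩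
    rw [hFΨc, norm_mul]
    apply mul_le_mul (VectorFourier.norm_fourierIntegral_le_integral_norm _ _ _ _ _) (hCu _)
      (norm_nonneg _) (integral_nonneg fun _ => norm_nonneg _)
  have hinv : 𝓕⁻ (𝓕 Ψc) = Ψc := hΨc_cont.fourierInv_fourier_eq hΨc_int hw_int
  refine ⟨𝓕 Ψc, hw_cont, hw_int, hw_bd, hw_zero, fun x => ?_⟩
  rw [hinv, hΨc, convolution_def, convolution_def, ← integral_complex_ofReal]
  congr 1
  funext t
  simp only [ContinuousLinearMap.mul_apply', hoc, hkc]
  by_cases ht : t ∈ U <;> simp [ht]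

end FourierSide

end Literature.Analysis.Fourier
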